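import Summits.QuantumFields.YangMills.Theorems.LangevinControlUVOSLegsFromFemtoAndGapStubAssemblyWeightBounds
import HarnessLib

/-!
# Soft OS-assembly toolkit VI-c: the `a`-uniform bound on the lattice `n`-point distributions from `MomentBounds`

Helper file for stub `stub_assembly` of crux `OSLegsFromFemtoAndGap` (stmt-QuantumFields-9367, line
`dlr-collar-transfer`): **`MomentBounds ⇒` E0′-type bounds, uniformly in the spacing.**  For `F ∈ ⁰𝒮ₙ` (`n ≥ 2`),
spacing `0 < a ≤ min 1 ℓ₄`, torus half-side `L ≥ 14` with `L ≥ a⁻²`, and coupling `β ≥ β₄`: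
`‖latticeDist r.ρ β L a (tr F²) ⟨tr F²⟩ n F‖ ≤ Kⁿ · (S₀,₄ₙ + S₆ₙ,₄ₙ + S₀,₀ + S₆ₙ,₀ + S₁₀ₙ,₀)(F)` with ONE constant
`K` (`latticeDist_norm_le_of_momentBounds`).  Per multi-site the three regimes of toolkit VI-b apply (wrap zone /
near-diagonal / separated — in the last one the collar radius
`R = min(⌊(δ−4)/2⌋, ⌊ℓ₄/a⌋, (L−8)/4)` meets the hypotheses of `MomentBounds` and `1/R ≤ 12/δ + a(2/ℓ₄+24)`), and the
resulting weights `a⁴ⁿ ∏ᵢ (1 + a‖xᵢ‖)⁻⁶` are summed by toolkit V.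
-/

noncomputable section

open scoped SchwartzMap BigOperators
open MeasureTheory Filter Topology
open Literature.MathematicalPhysics.QuantumFieldTheory Literature.MathematicalPhysics.QuantumLattice
open Literature.MathematicalPhysics.AQFT
open Literature.Probability.LatticeModels (box Site)
open Summit.QuantumFields.YangMills.Cruxes.OSLegsFromFemtoAndGap.DlrCollarTransfer (MomentBounds)

namespace Summit.QuantumFields.YangMills.Theorems.OSLegsFromFemtoAndGap

local notation "E4" => EuclideanSpace ℝ (Fin 4)

/-! ### Small arithmetic facts -/

/-- The sup norm of `v : ℤ⁴` is attained at a coordinate. -/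
theorem exists_norm_eq_abs_coord (v : Site 4) : ∃ k : Fin 4, ‖v‖ = |(v k : ℝ)| := by
  obtain ⟨k, -, hk⟩ := Finset.exists_max_image Finset.univ (fun k => ‖v k‖) ⟨0, Finset.mem_univ _⟩
  refine ⟨k, ?_⟩
  have h1 : ‖v‖ = ‖v k‖ :=
    le_antisymm ((pi_norm_le_iff_of_nonneg (norm_nonneg _)).2 fun k' => hk k' (Finset.mem_univ _))
      (norm_le_pi_norm v k)
  rw [h1, Int.norm_eq_abs]

/-- For reals `R₁ R₂ R₃ ≥ m > 0`… rather: `1 / min ≤ ∑ 1/Rᵢ` for positive reals. -/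
theorem inv_min_le_add {R₁ R₂ R₃ : ℝ} (h₁ : 0 < R₁) (h₂ : 0 < R₂) (h₃ : 0 < R₃) :
    (min R₁ (min R₂ R₃))⁻¹ ≤ R₁⁻¹ + R₂⁻¹ + R₃⁻¹ := by
  have hi₁ : 0 ≤ R₁⁻¹ := by positivity
  have hi₂ : 0 ≤ R₂⁻¹ := by positivity
  have hi₃ : 0 ≤ R₃⁻¹ := by positivity
  rcases min_choice R₁ (min R₂ R₃) with h | h <;> rw [h]
  · linarith
  · rcases min_choice R₂ R₃ with h' | h' <;> rw [h'] <;> linarith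

/-- **Choice of the collar radius** in the separated regime: for a closest-pair distance `δ ≥ 6`, collar
scale `ℓ₄`, spacing `0 < a ≤ min 1 ℓ₄` and torus half-side `L ≥ 14` with `L ≥ a⁻²`, the radius
`R = min(⌊(δ−4)/2⌋, ⌊ℓ₄/a⌋, (L−8)/4)` satisfies the three hypotheses of `MomentBounds`, fits inside the closest
pair (`2R + 4 ≤ δ`), and `1/R ≤ 12/δ + a (2/ℓ₄ + 24)`. -/
theorem exists_collar_radius {δ ℓ₄ a : ℝ} {L : ℕ} (hδ6 : 6 ≤ δ) (hℓ : 0 < ℓ₄) (ha : 0 < a) (ha1 : a ≤ 1)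
    (haℓ : a ≤ ℓ₄) (hL14 : 14 ≤ L) (hLa : a⁻¹ * a⁻¹ ≤ L) :
    ∃ R : ℕ, 1 ≤ R ∧ (R : ℝ) * a ≤ ℓ₄ ∧ 4 * R + 8 ≤ L ∧ 2 * (R : ℝ) + 4 ≤ δ ∧
      (R : ℝ)⁻¹ ≤ 12 / δ + a * (2 / ℓ₄ + 24) := by
  obtain ⟨R₁, hR₁⟩ : ∃ R₁ : ℕ, R₁ = ⌊(δ - 4) / 2⌋₊ := ⟨_, rfl⟩
  obtain ⟨R₂, hR₂⟩ : ∃ R₂ : ℕ, R₂ = ⌊ℓ₄ / a⌋₊ := ⟨_, rfl⟩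
  obtain ⟨R₃, hR₃⟩ : ∃ R₃ : ℕ, R₃ = (L - 8) / 4 := ⟨_, rfl⟩
  have hR₁1 : 1 ≤ R₁ := by rw [hR₁]; exact (Nat.one_le_floor_iff _).2 (by linarith)
  have hℓa : 1 ≤ ℓ₄ / a := by rw [le_div_iff₀ ha]; linarith
  have hR₂1 : 1 ≤ R₂ := by rw [hR₂]; exact (Nat.one_le_floor_iff _).2 hℓa
  have hR₃1 : 1 ≤ R₃ := by omega
  have hR₁pos : (0 : ℝ) < R₁ := by exact_mod_cast hR₁1
  have hR₂pos : (0 : ℝ) < R₂ := by exact_mod_cast hR₂1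
  have hR₃pos : (0 : ℝ) < R₃ := by exact_mod_cast hR₃1
  refine ⟨min R₁ (min R₂ R₃), le_min hR₁1 (le_min hR₂1 hR₃1), ?_, ?_, ?_, ?_⟩
  · -- `R a ≤ ℓ₄`
    have h1 : ((min R₁ (min R₂ R₃) : ℕ) : ℝ) ≤ R₂ := by
      exact_mod_cast (min_le_right _ _).trans (min_le_left _ _)
    have h2 : (R₂ : ℝ) ≤ ℓ₄ / a := by rw [hR₂]; exact Nat.floor_le (by positivity)
    calc ((min R₁ (min R₂ R₃) : ℕ) : ℝ) * a ≤ (ℓ₄ / a) * a := by gcongr; exact h1.trans h2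
      _ = ℓ₄ := by field_simp
  · -- `4R + 8 ≤ L`
    have h1 : min R₁ (min R₂ R₃) ≤ R₃ := (min_le_right _ _).trans (min_le_right _ _)
    omega
  · -- `2R + 4 ≤ δ`
    have h1 : ((min R₁ (min R₂ R₃) : ℕ) : ℝ) ≤ R₁ := by exact_mod_cast min_le_left _ _
    have h2 : (R₁ : ℝ) ≤ (δ - 4) / 2 := by rw [hR₁]; exact Nat.floor_le (by linarith)
    linarith
  · -- `1/R ≤ 12/δ + a (2/ℓ₄ + 24)`
    have h1 : δ / 12 ≤ (R₁ : ℝ) := by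
      rcases lt_or_ge δ 12 with hlt | hge
      · have : (1 : ℝ) ≤ R₁ := by exact_mod_cast hR₁1
        linarith
      · have := Nat.sub_one_lt_floor ((δ - 4) / 2)
        rw [← hR₁] at this
        linarith
    have h2 : ℓ₄ / a / 2 ≤ (R₂ : ℝ) := by
      -- `⌊t⌋₊ ≥ t/2` for `t = ℓ₄/a ≥ 1`
      rw [hR₂]
      rcases lt_or_ge (ℓ₄ / a) 2 with hlt | hge
      · have : (1 : ℝ) ≤ ⌊ℓ₄ / a⌋₊ := by exact_mod_cast (Nat.one_le_floor_iff _).2 hℓa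
        linarith
      · have := Nat.sub_one_lt_floor (ℓ₄ / a)
        linarith
    have h3 : a⁻¹ / 24 ≤ (R₃ : ℝ) := by
      have hdivN : L ≤ 4 * R₃ + 11 := by omega
      have hdiv' : (L : ℝ) ≤ 4 * (R₃ : ℝ) + 11 := by exact_mod_cast hdivN
      have hL14' : (14 : ℝ) ≤ L := by exact_mod_cast hL14
      have hainv1 : (1 : ℝ) ≤ a⁻¹ := one_le_inv_iff₀.2 ⟨ha, ha1⟩
      have hLinv : a⁻¹ ≤ (L : ℝ) := by
        have : a⁻¹ * 1 ≤ a⁻¹ * a⁻¹ := mul_le_mul_of_nonneg_left hainv1 (by positivity)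
        linarith
      linarith
    have hδpos : 0 < δ := by linarith
    have hi1 : (R₁ : ℝ)⁻¹ ≤ 12 / δ := by
      rw [inv_le_comm₀ hR₁pos (by positivity), inv_div]; exact h1
    have hi2 : (R₂ : ℝ)⁻¹ ≤ 2 * a / ℓ₄ := by
      rw [inv_le_comm₀ hR₂pos (by positivity), inv_div]
      have : ℓ₄ / (2 * a) = ℓ₄ / a / 2 := by rw [div_div, mul_comm]
      rw [this]; exact h2
    have hi3 : (R₃ : ℝ)⁻¹ ≤ 24 * a := by
      rw [inv_le_comm₀ hR₃pos (by positivity)]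
      have : (24 * a)⁻¹ = a⁻¹ / 24 := by rw [mul_inv, mul_comm, div_eq_mul_inv]
      rw [this]; exact h3
    rw [Nat.cast_min, Nat.cast_min]
    calc (min (R₁ : ℝ) (min (R₂ : ℝ) (R₃ : ℝ)))⁻¹ ≤ (R₁ : ℝ)⁻¹ + (R₂ : ℝ)⁻¹ + (R₃ : ℝ)⁻¹ :=
          inv_min_le_add hR₁pos hR₂pos hR₃pos
      _ ≤ 12 / δ + 2 * a / ℓ₄ + 24 * a := by linarith [hi1, hi2, hi3]
      _ = 12 / δ + a * (2 / ℓ₄ + 24) := by ring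

/-- **No wrap-around.** If every point sits in the bulk (`2‖xᵢ‖ ≤ L`), the torus distance of a pair along
the coordinate where their sup distance is attained equals the flat distance; hence any lower bound on the
flat distance transfers to the `valMinAbs` separation used by `MomentBounds`. -/
theorem exists_valMinAbs_ge_of_norm_le {L n : ℕ} (x : Fin n → Site 4) (hwrap : ∀ i, 2 * ‖x i‖ ≤ (L : ℝ))
    (i j : Fin n) {t : ℝ} (ht : t ≤ ‖x i - x j‖) :
    ∃ k : Fin 4, t ≤ ((|(((x i k - x j k : ℤ) : ZMod (2 * L + 1))).valMinAbs| : ℤ) : ℝ) := by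
  obtain ⟨k, hk⟩ := exists_norm_eq_abs_coord (x i - x j)
  refine ⟨k, ?_⟩
  have hxi : |(x i k : ℝ)| ≤ (L : ℝ) / 2 := by
    have h2 : (‖x i k‖ : ℝ) ≤ ‖x i‖ := norm_le_pi_norm (x i) k
    rw [Int.norm_eq_abs] at h2
    linarith [hwrap i]
  have hxj : |(x j k : ℝ)| ≤ (L : ℝ) / 2 := by
    have h2 : (‖x j k‖ : ℝ) ≤ ‖x j‖ := norm_le_pi_norm (x j) k
    rw [Int.norm_eq_abs] at h2
    linarith [hwrap j]
  have habsL : |x i k - x j k| ≤ (L : ℤ) := by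
    have h1 : |((x i k - x j k : ℤ) : ℝ)| ≤ L := by
      push_cast
      calc |(x i k : ℝ) - x j k| ≤ |(x i k : ℝ)| + |(x j k : ℝ)| := abs_sub _ _
        _ ≤ L := by linarith
    exact_mod_cast h1
  rw [valMinAbs_intCast_of_abs_le habsL, Int.cast_abs]
  have hdiff : ((x i - x j) k : ℝ) = ((x i k - x j k : ℤ) : ℝ) := by simp
  rw [← hdiff, ← hk]; exact ht

variable {G : Type} [Group G] [TopologicalSpace G] [IsTopologicalGroup G] [CompactSpace G]
  [MeasurableSpace G] [BorelSpace G]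

/-- **From per-point weights to the distribution.** A pointwise bound `|W(x)| ‖F(a x)‖ ≤ K ∏ᵢ w(xᵢ)` on the
moment weights sums to `‖latticeDist … F‖ ≤ K ∑ₓ ∏ᵢ w(xᵢ)`. -/
theorem norm_latticeDist_le_of_pointwise {N : ℕ} (ρ : G →* Matrix (Fin N) (Fin N) ℂ) (β : ℝ) (L : ℕ)
    (a : ℝ) (O : LGConfig 4 G → ℝ) (m : ℝ) {n : ℕ} (F : 𝓢((Fin n → E4), ℂ)) (K : ℝ) (w : Site 4 → ℝ)
    (hpt : ∀ x : Fin n → Site 4,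
      |torusMoment ρ β L O m x| * ‖F (fun i => a • siteToE (x i))‖ ≤ K * ∏ i, w (x i)) :
    ‖latticeDist ρ β L a O m n F‖ ≤
      K * ∑ x ∈ Fintype.piFinset (fun _ : Fin n => box 4 L), ∏ i, w (x i) := by
  rw [latticeDist_apply, Finset.mul_sum]
  refine (norm_sum_le _ _).trans (Finset.sum_le_sum fun x _ => ?_)
  rw [norm_mul, Complex.norm_real, Real.norm_eq_abs]
  exact hpt x

/-! ### The uniform bound -/

/-- **Separated regime of the per-point bound.** If no point is in the wrap zone and all pairs are `> 5`
apart, the closest pair `(i₀, j₀)` has integer distance `δ ≥ 6`; the collar radius of `exists_collar_radius`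
meets the hypotheses of the (unpacked) `MomentBounds` estimate `H`, and toolkit VI-b's far-regime bound applies. -/
theorem pointwise_bound_far (r : LatticeRep G) {C ℓ₄ a β : ℝ} {L n : ℕ} (hℓ : 0 < ℓ₄) (hC : 0 ≤ C)
    (H : ∀ (x : Fin n → Site 4) (R : ℕ), 1 ≤ R → (R : ℝ) * a ≤ ℓ₄ → 4 * R + 8 ≤ L →
      (∀ i j : Fin n, i ≠ j → ∃ k : Fin 4,
        (2 * (R : ℤ) + 4) ≤ |((((x i k - x j k : ℤ) : ZMod (2 * L + 1))).valMinAbs : ℤ)|) →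
      |torusMoment r.ρ β L r.curvature.F (wilsonTorusMean r.ρ β L r.curvature.F) x| ≤ (C / (R : ℝ) ^ 4) ^ n)
    (ha : 0 < a) (ha1 : a ≤ 1) (haℓ : a ≤ ℓ₄) (hL14 : 14 ≤ L) (hLa : a⁻¹ * a⁻¹ ≤ L) (hn : 2 ≤ n)
    (F : 𝓢((Fin n → E4), ℂ)) (hF : IsOffDiagonal F) (x : Fin n → Site 4)
    (hwrap : ∀ i, 2 * ‖x i‖ ≤ (L : ℝ)) (hnear : ∀ i j : Fin n, i ≠ j → 5 < ‖x i - x j‖) :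
    |torusMoment r.ρ β L r.curvature.F (wilsonTorusMean r.ρ β L r.curvature.F) x| *
        ‖F (fun i => a • siteToE (x i))‖ * (1 + ‖(fun i => a • siteToE (x i))‖) ^ (6 * n) ≤
      (16 * C) ^ n * 2 ^ (6 * n) * (2 / ℓ₄ + 24) ^ (4 * n) * a ^ (4 * n) *
        (SchwartzMap.seminorm ℂ 0 (4 * n) F + SchwartzMap.seminorm ℂ (6 * n) (4 * n) F +
          SchwartzMap.seminorm ℂ 0 0 F + SchwartzMap.seminorm ℂ (6 * n) 0 F) := by
  classical
  -- the set of ordered pairs is nonempty since `n ≥ 2`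
  have hpairs : (Finset.univ.filter fun p : Fin n × Fin n => p.1 ≠ p.2).Nonempty := by
    refine ⟨(⟨0, by omega⟩, ⟨1, by omega⟩), ?_⟩
    simp [Fin.ext_iff]
  obtain ⟨⟨i₀, j₀⟩, hmem, hmin⟩ :=
    Finset.exists_min_image _ (fun p : Fin n × Fin n => ‖x p.1 - x p.2‖) hpairs
  simp only [Finset.mem_filter, Finset.mem_univ, true_and] at hmem
  set δ : ℝ := ‖x i₀ - x j₀‖ with hδ
  have hδ5 : 5 < δ := hnear i₀ j₀ hmem
  have hδmin : ∀ i j : Fin n, i ≠ j → δ ≤ ‖x i - x j‖ := fun i j hij =>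
    hmin (i, j) (by simp [hij])
  -- `δ` is an integer, hence `δ ≥ 6`
  have hδ6 : 6 ≤ δ := by
    obtain ⟨k₀, hk₀⟩ := exists_norm_eq_abs_coord (x i₀ - x j₀)
    have h1 : δ = ((|(x i₀ - x j₀) k₀| : ℤ) : ℝ) := by rw [hδ, hk₀, Int.cast_abs]
    have h2 : (5 : ℝ) < ((|(x i₀ - x j₀) k₀| : ℤ) : ℝ) := h1 ▸ hδ5
    have h3 : (5 : ℤ) < |(x i₀ - x j₀) k₀| := by exact_mod_cast h2
    have h4 : (6 : ℤ) ≤ |(x i₀ - x j₀) k₀| := h3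
    rw [h1]; exact_mod_cast h4
  have hδpos : 0 < δ := by linarith
  -- collar radius
  obtain ⟨R, hR1, hRa, hRL, hRδ, hRinv⟩ := exists_collar_radius hδ6 hℓ ha ha1 haℓ hL14 hLa
  have hRpos : (0 : ℝ) < R := by exact_mod_cast hR1
  -- separation with no wrap-around
  have hsep : ∀ i j : Fin n, i ≠ j → ∃ k : Fin 4,
      (2 * (R : ℤ) + 4) ≤ |((((x i k - x j k : ℤ) : ZMod (2 * L + 1))).valMinAbs : ℤ)| := by
    intro i j hij
    obtain ⟨k, hk⟩ := exists_valMinAbs_ge_of_norm_le x hwrap i j (hRδ.trans (hδmin i j hij))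
    refine ⟨k, ?_⟩
    exact_mod_cast hk
  -- the collar bound and the far-regime estimate
  exact weight_bound_far F hF ha x hmem hδpos (le_of_eq hδ.symm) hC hRpos hℓ (H x R hR1 hRa hRL hsep) hRinv

/-- **Per-point bound, all regimes.** With `M = C₀ + C₀` the sup bound of the centred weights, the three
regimes (wrap zone / near-diagonal / separated) of toolkit VI-b combine into
`|W(x)| ‖F(a x)‖ (1 + ‖a x‖)^{6n} ≤ K₀ⁿ a^{4n} (S₀,₄ₙ + S₆ₙ,₄ₙ + S₀,₀ + S₆ₙ,₀ + S₁₀ₙ,₀)(F)` with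
`K₀ = M·2⁴·3⁶ + M·2⁶·10⁴ + 16C·2⁶·(2/ℓ₄+24)⁴`. -/
theorem pointwise_bound (r : LatticeRep G) {C ℓ₄ C₀ a β : ℝ} {L n : ℕ} (hℓ : 0 < ℓ₄) (hC : 0 ≤ C)
    (hC₀ : ∀ U, |r.curvature.F U| ≤ C₀)
    (H : ∀ (x : Fin n → Site 4) (R : ℕ), 1 ≤ R → (R : ℝ) * a ≤ ℓ₄ → 4 * R + 8 ≤ L →
      (∀ i j : Fin n, i ≠ j → ∃ k : Fin 4,
        (2 * (R : ℤ) + 4) ≤ |((((x i k - x j k : ℤ) : ZMod (2 * L + 1))).valMinAbs : ℤ)|) →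
      |torusMoment r.ρ β L r.curvature.F (wilsonTorusMean r.ρ β L r.curvature.F) x| ≤ (C / (R : ℝ) ^ 4) ^ n)
    (ha : 0 < a) (ha1 : a ≤ 1) (haℓ : a ≤ ℓ₄) (hL14 : 14 ≤ L) (hLa : a⁻¹ * a⁻¹ ≤ L) (hn : 2 ≤ n)
    (F : 𝓢((Fin n → E4), ℂ)) (hF : IsOffDiagonal F) (x : Fin n → Site 4) :
    |torusMoment r.ρ β L r.curvature.F (wilsonTorusMean r.ρ β L r.curvature.F) x| *
        ‖F (fun i => a • siteToE (x i))‖ * (1 + ‖(fun i => a • siteToE (x i))‖) ^ (6 * n) ≤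
      ((C₀ + C₀) * 2 ^ 4 * 3 ^ 6 + (C₀ + C₀) * 2 ^ 6 * 10 ^ 4 + 16 * C * 2 ^ 6 * (2 / ℓ₄ + 24) ^ 4) ^ n *
        a ^ (4 * n) *
        (SchwartzMap.seminorm ℂ 0 (4 * n) F + SchwartzMap.seminorm ℂ (6 * n) (4 * n) F +
          SchwartzMap.seminorm ℂ 0 0 F + SchwartzMap.seminorm ℂ (6 * n) 0 F +
          SchwartzMap.seminorm ℂ (10 * n) 0 F) := by
  classical
  have hC₀0 : 0 ≤ C₀ := le_trans (abs_nonneg _) (hC₀ (fun _ => 1))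
  set Mw : ℝ := C₀ + C₀ with hMw
  have hMw0 : 0 ≤ Mw := by positivity
  set κ : ℝ := 2 / ℓ₄ + 24 with hκ
  have hκ0 : 0 < κ := by rw [hκ]; positivity
  set K₀ : ℝ := Mw * 2 ^ 4 * 3 ^ 6 + Mw * 2 ^ 6 * 10 ^ 4 + 16 * C * 2 ^ 6 * κ ^ 4 with hK₀
  set m := wilsonTorusMean r.ρ β L r.curvature.F with hm
  have hm_le : |m| ≤ C₀ := abs_wilsonTorusMean_le r β L r.curvature hC₀
  have hWsup : |torusMoment r.ρ β L r.curvature.F m x| ≤ Mw ^ n :=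
    (abs_torusMoment_le_pow r β L r.curvature hC₀ m x).trans
      (pow_le_pow_left₀ (by positivity) (by rw [hMw]; linarith) n)
  set S04 := SchwartzMap.seminorm ℂ 0 (4 * n) F
  set S64 := SchwartzMap.seminorm ℂ (6 * n) (4 * n) F
  set S00 := SchwartzMap.seminorm ℂ 0 0 F
  set S60 := SchwartzMap.seminorm ℂ (6 * n) 0 F
  set S10 := SchwartzMap.seminorm ℂ (10 * n) 0 F
  have hS04 : 0 ≤ S04 := apply_nonneg _ _
  have hS64 : 0 ≤ S64 := apply_nonneg _ _
  have hS00 : 0 ≤ S00 := apply_nonneg _ _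
  have hS60 : 0 ≤ S60 := apply_nonneg _ _
  have hS10 : 0 ≤ S10 := apply_nonneg _ _
  have ha4 : 0 ≤ a ^ (4 * n) := by positivity
  -- each regime constant is `≤ K₀`
  have hKwrap : Mw * 2 ^ 4 * 3 ^ 6 ≤ K₀ := by rw [hK₀]; nlinarith [hMw0, hC, pow_pos hκ0 4]
  have hKnear : Mw * 2 ^ 6 * 10 ^ 4 ≤ K₀ := by rw [hK₀]; nlinarith [hMw0, hC, pow_pos hκ0 4]
  have hKfar : 16 * C * 2 ^ 6 * κ ^ 4 ≤ K₀ := by rw [hK₀]; nlinarith [hMw0, hC, pow_pos hκ0 4]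
  have hK₀0 : 0 ≤ K₀ := le_trans (by positivity) hKwrap
  have hpow : ∀ u v w : ℝ, ∀ p q : ℕ, u ^ n * v ^ (p * n) * w ^ (q * n) = (u * v ^ p * w ^ q) ^ n := by
    intro u v w p q; rw [mul_pow, mul_pow, ← pow_mul, ← pow_mul]
  by_cases hwrap : ∃ i, (L : ℝ) < 2 * ‖x i‖
  · -- WRAP ZONE
    obtain ⟨i, hi⟩ := hwrap
    calc _ ≤ Mw ^ n * 2 ^ (4 * n) * 3 ^ (6 * n) * a ^ (4 * n) * S10 :=
          weight_bound_wrap F ha ha1 hLa x hi hMw0 hWsup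
      _ = (Mw * 2 ^ 4 * 3 ^ 6) ^ n * a ^ (4 * n) * S10 := by rw [← hpow]
      _ ≤ K₀ ^ n * a ^ (4 * n) * (S04 + S64 + S00 + S60 + S10) := by
          have : S10 ≤ S04 + S64 + S00 + S60 + S10 := by linarith
          gcongr
  · push Not at hwrap
    by_cases hnear : ∃ i j : Fin n, i ≠ j ∧ ‖x i - x j‖ ≤ 5
    · -- NEAR-DIAGONAL
      obtain ⟨i, j, hij, hclose⟩ := hnear
      calc _ ≤ Mw ^ n * 2 ^ (6 * n) * 10 ^ (4 * n) * a ^ (4 * n) * (S04 + S64) :=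
            weight_bound_near F hF ha x hij hclose hMw0 hWsup
        _ = (Mw * 2 ^ 6 * 10 ^ 4) ^ n * a ^ (4 * n) * (S04 + S64) := by rw [← hpow]
        _ ≤ K₀ ^ n * a ^ (4 * n) * (S04 + S64 + S00 + S60 + S10) := by
            have : S04 + S64 ≤ S04 + S64 + S00 + S60 + S10 := by linarith
            gcongr
    · -- SEPARATED
      push Not at hnear
      calc _ ≤ (16 * C) ^ n * 2 ^ (6 * n) * κ ^ (4 * n) * a ^ (4 * n) * (S04 + S64 + S00 + S60) :=
            pointwise_bound_far r hℓ hC H ha ha1 haℓ hL14 hLa hn F hF x hwrap hnear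
        _ = (16 * C * 2 ^ 6 * κ ^ 4) ^ n * a ^ (4 * n) * (S04 + S64 + S00 + S60) := by rw [← hpow]
        _ ≤ K₀ ^ n * a ^ (4 * n) * (S04 + S64 + S00 + S60 + S10) := by
            have : S04 + S64 + S00 + S60 ≤ S04 + S64 + S00 + S60 + S10 := by linarith
            gcongr

/-- **`MomentBounds ⇒ a`-uniform bounds on the lattice `n`-point distributions** (E0′ shape: one exponential
constant, the seminorm budget `S₀,₄ₙ + S₆ₙ,₄ₙ + S₀,₀ + S₆ₙ,₀ + S₁₀ₙ,₀ ≤ 5 · schwartzNorm (10n)`), for test functions of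
`⁰𝒮`, spacings `0 < a ≤ min 1 ℓ₄` and tori `L ≥ 14`, `L ≥ a⁻²`, `n ≥ 2`. -/
theorem latticeDist_norm_le_of_momentBounds (r : LatticeRep G) {a : ℝ → ℝ} (hMB : MomentBounds G r a) :
    ∃ (β₄ ℓ₄ K : ℝ), 0 < ℓ₄ ∧ 0 ≤ K ∧ ∀ β : ℝ, β₄ ≤ β → 0 < a β → a β ≤ 1 → a β ≤ ℓ₄ →
      ∀ L : ℕ, 14 ≤ L → (a β)⁻¹ * (a β)⁻¹ ≤ L →
      ∀ n : ℕ, 2 ≤ n → ∀ F : 𝓢((Fin n → E4), ℂ), IsOffDiagonal F →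
        ‖latticeDist r.ρ β L (a β) r.curvature.F (wilsonTorusMean r.ρ β L r.curvature.F) n F‖ ≤
          K ^ n * (SchwartzMap.seminorm ℂ 0 (4 * n) F + SchwartzMap.seminorm ℂ (6 * n) (4 * n) F +
            SchwartzMap.seminorm ℂ 0 0 F + SchwartzMap.seminorm ℂ (6 * n) 0 F +
            SchwartzMap.seminorm ℂ (10 * n) 0 F) := by
  classical
  obtain ⟨C, β₄, ℓ₄, hℓ, hC, H⟩ := abs_torusMoment_le_of_momentBounds r hMB
  obtain ⟨C₀, hC₀⟩ := r.curvature.bounded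
  have hC₀0 : 0 ≤ C₀ := le_trans (abs_nonneg _) (hC₀ (fun _ => 1))
  -- the per-point constant of `pointwise_bound` and the lattice-sum constant of toolkit V
  set K₀ : ℝ := (C₀ + C₀) * 2 ^ 4 * 3 ^ 6 + (C₀ + C₀) * 2 ^ 6 * 10 ^ 4 + 16 * C * 2 ^ 6 * (2 / ℓ₄ + 24) ^ 4
    with hK₀
  set Z : ℝ := 81 * ∑' m : ℕ, (((m : ℝ) + 1) ^ 2)⁻¹ with hZ
  have hZ0 : 0 ≤ Z := by rw [hZ]; exact mul_nonneg (by norm_num) (tsum_nonneg fun m => by positivity)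
  have hK₀0 : 0 ≤ K₀ := by rw [hK₀]; positivity
  refine ⟨β₄, ℓ₄, K₀ * Z, hℓ, mul_nonneg hK₀0 hZ0, ?_⟩
  intro β hβ ha ha1 haℓ L hL14 hLa n hn F hF
  set a' := a β with ha'
  set m := wilsonTorusMean r.ρ β L r.curvature.F with hm
  set Ssum := SchwartzMap.seminorm ℂ 0 (4 * n) F + SchwartzMap.seminorm ℂ (6 * n) (4 * n) F +
    SchwartzMap.seminorm ℂ 0 0 F + SchwartzMap.seminorm ℂ (6 * n) 0 F + SchwartzMap.seminorm ℂ (10 * n) 0 F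
    with hSsum
  have hSsum0 : 0 ≤ Ssum := by positivity
  -- FROM THE PER-POINT BOUND TO THE WEIGHTS `a⁴ⁿ ∏ (1 + a‖xᵢ‖)⁻⁶`
  have hpt' : ∀ x : Fin n → Site 4,
      |torusMoment r.ρ β L r.curvature.F m x| * ‖F (fun i => a' • siteToE (x i))‖ ≤
        K₀ ^ n * Ssum * ∏ i, (fun z : Site 4 => a' ^ 4 * ((1 + a' * ‖z‖) ^ 6)⁻¹) (x i) := by
    intro x
    set y : Fin n → E4 := fun i => a' • siteToE (x i) with hy
    have hq : 0 < (1 + ‖y‖) ^ (6 * n) := by positivity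
    have h1 := pointwise_bound r hℓ hC hC₀ (H β hβ L n) ha ha1 haℓ hL14 hLa hn F hF x
    have h2 : |torusMoment r.ρ β L r.curvature.F m x| * ‖F y‖ ≤
        K₀ ^ n * a' ^ (4 * n) * Ssum * ((1 + ‖y‖) ^ (6 * n))⁻¹ := by
      rw [← div_eq_mul_inv, le_div_iff₀ hq]; exact h1
    have h3 : ((1 + ‖y‖) ^ (6 * n))⁻¹ ≤ ∏ i, ((1 + a' * ‖x i‖) ^ 6)⁻¹ := by
      have := inv_one_add_norm_pow_le_prod ha.le x y (fun i => mul_norm_le_norm_smul_siteToE ha.le (x i)) 6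
      rw [inv_pow, ← pow_mul] at this
      exact this
    have h4 : a' ^ (4 * n) * ∏ i, ((1 + a' * ‖x i‖) ^ 6)⁻¹ = ∏ i, (a' ^ 4 * ((1 + a' * ‖x i‖) ^ 6)⁻¹) := by
      rw [Finset.prod_mul_distrib, Finset.prod_const, Finset.card_univ, Fintype.card_fin, pow_mul]
    calc |torusMoment r.ρ β L r.curvature.F m x| * ‖F y‖
        ≤ K₀ ^ n * a' ^ (4 * n) * Ssum * ((1 + ‖y‖) ^ (6 * n))⁻¹ := h2
      _ ≤ K₀ ^ n * a' ^ (4 * n) * Ssum * ∏ i, ((1 + a' * ‖x i‖) ^ 6)⁻¹ := by gcongr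
      _ = K₀ ^ n * Ssum * (a' ^ (4 * n) * ∏ i, ((1 + a' * ‖x i‖) ^ 6)⁻¹) := by ring
      _ = K₀ ^ n * Ssum * ∏ i, (a' ^ 4 * ((1 + a' * ‖x i‖) ^ 6)⁻¹) := by rw [h4]
  -- SUM OVER THE TORUS
  calc ‖latticeDist r.ρ β L a' r.curvature.F m n F‖
      ≤ K₀ ^ n * Ssum * ∑ x ∈ Fintype.piFinset (fun _ : Fin n => box 4 L),
          ∏ i, (fun z : Site 4 => a' ^ 4 * ((1 + a' * ‖z‖) ^ 6)⁻¹) (x i) :=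
        norm_latticeDist_le_of_pointwise r.ρ β L a' r.curvature.F m F (K₀ ^ n * Ssum)
          (fun z : Site 4 => a' ^ 4 * ((1 + a' * ‖z‖) ^ 6)⁻¹) hpt'
    _ ≤ K₀ ^ n * Ssum * Z ^ n := by
        have hKS : 0 ≤ K₀ ^ n * Ssum := mul_nonneg (pow_nonneg hK₀0 n) hSsum0
        refine mul_le_mul_of_nonneg_left ?_ hKS
        rw [hZ]; exact sum_prod_decay_le ha ha1 (le_refl 6) (box 4 L) n
    _ = (K₀ * Z) ^ n * Ssum := by rw [mul_pow (K₀) Z n]; ring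

end Summit.QuantumFields.YangMills.Theorems.OSLegsFromFemtoAndGap

end
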